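import Literature.AlgebraicGeometry.Morphisms.FormalModuleCokernel
import HarnessLib

/-!
# Nakayama for coherent formal modules: a morphism of towers onto at level `0` is onto at every level

Görtz–Wedhorn, *Algebraic Geometry II* (2023), proof of Lemma 24.103 (p. 570): a morphism `u : ℱ → 𝒢`
of `𝒪_{X/Z}`-modules which is surjective modulo the ideal of definition is surjective (the ideal is
nilpotent on each level). In the quotient model of `Morphisms/FormalModuleTower` along one global
function `a`:

* `IsFormalTower.isZero_of_isZero_zero` — a formal tower whose level `0` vanishes vanishes
  identically (`C_{n+1} —aⁿ⁺¹→ C_{n+1} → C_n = 0` exact forces multiplication by `aⁿ⁺¹` to be an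
  epimorphism of square zero, hence zero);
* `IsFormalTower.epi_app_of_epi_app_zero` — **for `u : F → G` with `F` having epimorphic transitions
  and `G` a formal tower, `Epi (u_0)` implies `Epi (u_n)` for all `n`** (apply the above to the
  cokernel tower, `Morphisms/FormalModuleCokernel`).

Everything is proved; no named facts.

## References

* U. Görtz, T. Wedhorn, *Algebraic Geometry II: Cohomology of Schemes*, Springer Spektrum (2023),
  Lemma 24.103, proof, and Prop. 24.91 (pp. 565, 570). [GortzWedhorn2023]
* A. Grothendieck, EGA III₁ (1961), 5.1–5.2. [EGAIII1]
-/

noncomputable section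

open CategoryTheory AlgebraicGeometry Limits TopologicalSpace Opposite
open Literature.AlgebraicGeometry.Modules

universe u

namespace Literature.AlgebraicGeometry.Morphisms

namespace IsFormalTower

variable {X : Scheme.{u}} {a : Γ(X, ⊤)}

/-- **A formal tower vanishing at level `0` vanishes at every level.** If `C_n = 0`, exactness of
`C_{n+1} —aⁿ⁺¹→ C_{n+1} → C_n` makes multiplication by `aⁿ⁺¹` an epimorphism of `C_{n+1}`; its square
is multiplication by `a²ⁿ⁺²`, which is zero (`aⁿ⁺²C_{n+1} = 0`), so it is zero and `C_{n+1} = 0`.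
[cite: GortzWedhorn2023, Lemma 24.103, proof (p. 570)] -/
theorem isZero_of_isZero_zero {C : ℕᵒᵖ ⥤ X.Modules} (hC : IsFormalTower a C)
    (h0 : IsZero (C.obj ⟨0⟩)) : ∀ n, IsZero (C.obj ⟨n⟩)
  | 0 => h0
  | n + 1 => by
    have hn := isZero_of_isZero_zero hC h0 n
    -- multiplication by `aⁿ⁺¹` on `C_{n+1}` is an epimorphism …
    have hepi : Epi (globalScalar (C.obj ⟨n + 1⟩) (a ^ (n + 1))) :=
      (hC.exact n).epi_f (hn.eq_of_tgt _ _)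
    -- … of square zero, hence zero
    have hsq : globalScalar (C.obj ⟨n + 1⟩) (a ^ (n + 1)) ≫
        globalScalar (C.obj ⟨n + 1⟩) (a ^ (n + 1)) = 0 := by
      rw [← globalScalar_mul, ← pow_add]
      exact hC.killed_of_le (show n + 1 ≤ n + 1 + n by omega)
    have hzero : globalScalar (C.obj ⟨n + 1⟩) (a ^ (n + 1)) = 0 := by
      rw [← cancel_epi (globalScalar (C.obj ⟨n + 1⟩) (a ^ (n + 1))), hsq, comp_zero]
    exact IsZero.of_epi_eq_zero _ hzero

/-- **Nakayama for formal towers**: a morphism `u : F → G` from a tower with epimorphic transition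
maps to a formal tower which is an epimorphism at level `0` is an epimorphism at every level (its
cokernel tower is a formal tower vanishing at level `0`).
[cite: GortzWedhorn2023, Lemma 24.103, proof (p. 570)] -/
theorem epi_app_of_epi_app_zero {F G : ℕᵒᵖ ⥤ X.Modules} (hFe : ∀ n, Epi (towerπ F n))
    (hG : IsFormalTower a G) (u : F ⟶ G) [Epi (u.app ⟨0⟩)] (n : ℕ) : Epi (u.app ⟨n⟩) := by
  have hC : IsFormalTower a (Morphisms.cokerTower u) := IsFormalTower.cokerTower hFe hG
  have h0 : IsZero ((Morphisms.cokerTower u).obj ⟨0⟩) := isZero_cokernel_of_epi (u.app ⟨0⟩)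
  exact Preadditive.epi_of_isZero_cokernel' _ (cokernelIsCokernel (u.app ⟨n⟩))
    (hC.isZero_of_isZero_zero h0 n)

end IsFormalTower

end Literature.AlgebraicGeometry.Morphisms

end
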